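import Mathlib
import Summits.CriticalPhenomena.Ising3DConformalLimit.Theorems.PrecisionLaplacianEtaBoundsTransferOrtho
import Literature.Probability.LatticeModels.SharpnessProofs
import HarnessLib

/-!
# Stubs `stub_spectralParseval` and `stub_autocorrelationCount` of line
# `diffusive-branch-is-nonsaturation` (crux `PrecisionLaplacian.DirectCorrelationStableTail`,
# stmt-CriticalPhenomena-4799)

Two Ising-free ingredients of the Fourier side (step D2) of the line, on the cube
`K = [-π,π]³` with the approximate spectral density
`g̃_L(k) = Σ_{z,z' ∈ Λ_L} G(z'−z) cos(k·(z'−z))` of an even kernel `G : ℤ³ → ℝ`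
(`Λ_L = box 3 L = {−L,…,L}³`, `k·z = phase 3 k z`).

* `stub_spectralParseval` (registered text of the lead's skeleton, verbatim): for a finite
  `S ⊆ ℤ³` and coefficients `u`,
  `∫_K (Σ_{x,x'∈S} u_x u_{x'} cos k·(x'−x)) g̃_L(k) dk
     = (2π)³ Σ_{x,x'∈S} u_x u_{x'} G(x'−x) · #{(z,z') ∈ Λ_L² : z'−z = x'−x}`.
  Proof: expand into a finite sum, exchange with the integral (continuity on the compact cube),
  use the orthogonality relation `∫_K cos(k·m) cos(k·n) dk = (2π)³/2 ([m = n] + [m = −n])`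
  (`EtaBoundsTransfer.integral_cube_cos_mul_cos`); the `[m = n]` half summed over
  `(z,z') ∈ Λ_L²` is `G(m) · #{z'−z = m}`, and the `[m = −n]` half equals the first after the
  swap `(z,z') ↦ (z',z)` (`Finset.sum_comm`) and evenness of `G`.
* `stub_autocorrelationCount` (registered text, verbatim): the autocorrelation of the cube,
  `#{(z,z') ∈ Λ_L² : z'−z = w} ≤ (2L+1)³` (projection to `z` is injective),
  `≥ (2(L−‖w‖_∞)+1)³` for `‖w‖_∞ ≤ L` (`z ↦ (z, z+w)` embeds `Λ_{L−‖w‖}`), hence the ratio to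
  `(2L+1)³` tends to `1` (squeeze).

Pure theorem file, no definitions, no `sorry`. [folklore]
-/

noncomputable section

namespace Summit.CriticalPhenomena.Ising3DConformalLimit.Cruxes.DirectCorrelationStableTail.DiffusiveBranchIsNonsaturation

open MeasureTheory Filter Topology
open scoped BigOperators
open Literature.Probability.LatticeModels
open Summit.CriticalPhenomena.Ising3DConformalLimit.Theorems.EtaBoundsTransfer

/-! ### Counting the autocorrelation of the cube -/

/-- An indicator-weighted kernel summed over `B × B` collapses to
`G m · #{(z,z') ∈ B² : z' − z = m}`. [folklore] -/
theorem sum_sum_ite_eq_mul_card (G : Site 3 → ℝ) (B : Finset (Site 3)) (m : Site 3) :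
    ∑ z ∈ B, ∑ z' ∈ B, (if m = z' - z then G (z' - z) else 0)
      = G m * (((B ×ˢ B).filter (fun p : Site 3 × Site 3 => p.2 - p.1 = m)).card : ℝ) := by
  rw [Finset.natCast_card_filter, Finset.mul_sum, Finset.sum_product]
  refine Finset.sum_congr rfl fun z _ => Finset.sum_congr rfl fun z' _ => ?_
  dsimp only
  by_cases h : z' - z = m
  · rw [if_pos h.symm, if_pos h, h, mul_one]
  · rw [if_neg (fun h' => h h'.symm), if_neg h, mul_zero]

/-- Upper count: `#{(z,z') ∈ Λ_L² : z' − z = w} ≤ (2L+1)³`, since `(z,z') ↦ z` is injective on the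
fibre. [folklore] -/
theorem autocorrelationCount_le (w : Site 3) (L : ℕ) :
    (((box 3 L) ×ˢ (box 3 L)).filter (fun p : Site 3 × Site 3 => p.2 - p.1 = w)).card
      ≤ (2 * L + 1) ^ 3 := by
  rw [← card_box 3 L]
  refine Finset.card_le_card_of_injOn Prod.fst (fun p hp => ?_) (fun p hp q hq h => ?_)
  · have h1 := (Finset.mem_filter.1 (Finset.mem_coe.1 hp)).1
    exact (Finset.mem_product.1 h1).1
  · obtain ⟨_, hp2⟩ := Finset.mem_filter.1 (Finset.mem_coe.1 hp)
    obtain ⟨_, hq2⟩ := Finset.mem_filter.1 (Finset.mem_coe.1 hq)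
    rw [sub_eq_iff_eq_add] at hp2 hq2
    exact Prod.ext h (by rw [hp2, hq2, h])

/-- Lower count: for `‖w‖_∞ ≤ L`, `(2(L−‖w‖_∞)+1)³ ≤ #{(z,z') ∈ Λ_L² : z' − z = w}`, since
`z ↦ (z, z + w)` embeds `Λ_{L−‖w‖}` into the fibre. [folklore] -/
theorem autocorrelationCount_ge (w : Site 3) (L : ℕ) (hw : Site.supNorm w ≤ L) :
    (2 * (L - Site.supNorm w) + 1) ^ 3
      ≤ (((box 3 L) ×ˢ (box 3 L)).filter (fun p : Site 3 × Site 3 => p.2 - p.1 = w)).card := by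
  rw [← card_box 3 (L - Site.supNorm w)]
  refine Finset.card_le_card_of_injOn (fun z => (z, z + w)) (fun z hz => ?_) (fun z _ z' _ h => ?_)
  · rw [Finset.mem_coe, mem_box_iff_supNorm_le] at hz
    rw [Finset.mem_coe, Finset.mem_filter, Finset.mem_product, mem_box_iff_supNorm_le,
      mem_box_iff_supNorm_le]
    dsimp only
    exact ⟨⟨by omega, (Site.supNorm_add_le z w).trans (by omega)⟩, add_sub_cancel_left z w⟩
  · exact congrArg Prod.fst h

/-- **Stub B `stub_autocorrelationCount` (the autocorrelation of the cube; Ising-free counting).**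
`#{(z,z') ∈ Λ_L² : z' − z = w} ≤ (2L+1)³` (projection to `z`), `≥ (2(L−‖w‖)+1)³` for `‖w‖∞ ≤ L` (pairs with
`z ∈ Λ_{L−‖w‖}`), hence `#{…}/(2L+1)³ → 1` as `L → ∞`. [folklore] -/
theorem stub_autocorrelationCount :
    ∀ w : Site 3,
      (∀ L : ℕ, (((box 3 L) ×ˢ (box 3 L)).filter (fun p : Site 3 × Site 3 => p.2 - p.1 = w)).card ≤ (2 * L + 1) ^ 3) ∧
      (∀ L : ℕ, Site.supNorm w ≤ L → (2 * (L - Site.supNorm w) + 1) ^ 3 ≤ (((box 3 L) ×ˢ (box 3 L)).filter (fun p : Site 3 × Site 3 => p.2 - p.1 = w)).card) ∧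
      Filter.Tendsto (fun L : ℕ => ((((box 3 L) ×ˢ (box 3 L)).filter (fun p : Site 3 × Site 3 => p.2 - p.1 = w)).card : ℝ) / ((2 * (L : ℝ) + 1) ^ 3)) Filter.atTop (nhds 1) := by
  intro w
  refine ⟨autocorrelationCount_le w, autocorrelationCount_ge w, ?_⟩
  set m : ℕ := Site.supNorm w with hm
  have h1 : Tendsto (fun L : ℕ => (2 * (L : ℝ) + 1)) atTop atTop :=
    tendsto_atTop_add_const_right _ _ (tendsto_natCast_atTop_atTop.const_mul_atTop two_pos)
  have h2 : Tendsto (fun L : ℕ => (2 * (m : ℝ)) / (2 * (L : ℝ) + 1)) atTop (nhds 0) :=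
    tendsto_const_nhds.div_atTop h1
  have h3 : Tendsto (fun L : ℕ => (1 - (2 * (m : ℝ)) / (2 * (L : ℝ) + 1)) ^ 3) atTop (nhds 1) := by
    have h4 := ((tendsto_const_nhds (x := (1 : ℝ))).sub h2).pow 3
    rw [sub_zero, one_pow] at h4
    exact h4
  refine tendsto_of_tendsto_of_tendsto_of_le_of_le' h3 tendsto_const_nhds ?_ ?_
  · filter_upwards [eventually_ge_atTop m] with L hL
    have hlow := autocorrelationCount_ge w L hL
    have hpos : (0 : ℝ) < 2 * (L : ℝ) + 1 := by positivity
    have key : (1 - (2 * (m : ℝ)) / (2 * (L : ℝ) + 1)) ^ 3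
        = (((2 * (L - m) + 1) ^ 3 : ℕ) : ℝ) / (2 * (L : ℝ) + 1) ^ 3 := by
      push_cast [Nat.cast_sub hL]
      rw [← div_pow]
      congr 1
      field_simp
      ring
    rw [key, div_le_div_iff_of_pos_right (pow_pos hpos 3)]
    exact_mod_cast hlow
  · filter_upwards with L
    have hpos : (0 : ℝ) < (2 * (L : ℝ) + 1) ^ 3 := by positivity
    rw [div_le_one hpos]
    exact_mod_cast autocorrelationCount_le w L

/-! ### Parseval against the approximate spectral density -/

/-- The approximate spectral density `g̃_L` is continuous in `k`. [folklore] -/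
theorem continuous_approxSpectralDensity (G : Site 3 → ℝ) (L : ℕ) :
    Continuous fun k : Fin 3 → ℝ =>
      ∑ z ∈ box 3 L, ∑ z' ∈ box 3 L, G (z' - z) * Real.cos (phase 3 k (z' - z)) := by
  refine continuous_finsetSum _ fun z _ => continuous_finsetSum _ fun z' _ => ?_
  exact continuous_const.mul (Real.continuous_cos.comp (continuous_phase _))

/-- Exchange of the finite quadratic-form sum with the cube integral: for a continuous weight
`W`, `∫_K (Σ_{x,x'∈S} u_x u_{x'} cos k·(x'−x)) W(k) dk = Σ_{x,x'} u_x u_{x'} ∫_K cos k·(x'−x) W(k) dk`.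
[folklore] -/
theorem integral_quadraticForm_mul (S : Finset (Site 3)) (u : Site 3 → ℝ) (W : (Fin 3 → ℝ) → ℝ)
    (hW : Continuous W) :
    ∫ k in Set.pi Set.univ (fun _ : Fin 3 => Set.Icc (-Real.pi) Real.pi),
        (∑ x ∈ S, ∑ x' ∈ S, u x * u x' * Real.cos (phase 3 k (x' - x))) * W k
      = ∑ x ∈ S, ∑ x' ∈ S, u x * u x' *
          ∫ k in Set.pi Set.univ (fun _ : Fin 3 => Set.Icc (-Real.pi) Real.pi),
            Real.cos (phase 3 k (x' - x)) * W k := by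
  have h1 : ∀ k : Fin 3 → ℝ, (∑ x ∈ S, ∑ x' ∈ S, u x * u x' * Real.cos (phase 3 k (x' - x))) * W k
      = ∑ x ∈ S, ∑ x' ∈ S, u x * u x' * (Real.cos (phase 3 k (x' - x)) * W k) := by
    intro k
    rw [Finset.sum_mul]
    refine Finset.sum_congr rfl fun x _ => ?_
    rw [Finset.sum_mul]
    refine Finset.sum_congr rfl fun x' _ => ?_
    ring
  simp_rw [h1]
  have hi : ∀ x x' : Site 3, Integrable
      (fun k : Fin 3 → ℝ => u x * u x' * (Real.cos (phase 3 k (x' - x)) * W k))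
      (volume.restrict (Set.pi Set.univ (fun _ : Fin 3 => Set.Icc (-Real.pi) Real.pi))) := by
    intro x x'
    refine integrableOn_cube_of_continuous ?_
    have := continuous_phase (d := 3) (x' - x)
    fun_prop
  rw [integral_finsetSum _ (fun x _ => integrable_finsetSum _ (fun x' _ => hi x x'))]
  simp_rw [integral_finsetSum _ (fun x' _ => hi _ x'), integral_const_mul]

/-- The one-mode Parseval identity: for an even kernel `G`,
`∫_K cos(k·m) g̃_L(k) dk = (2π)³ G(m) · #{(z,z') ∈ Λ_L² : z' − z = m}`. [folklore] -/
theorem integral_cos_mul_approxSpectralDensity (G : Site 3 → ℝ) (hG : ∀ w, G (-w) = G w) (L : ℕ)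
    (m : Site 3) :
    ∫ k in Set.pi Set.univ (fun _ : Fin 3 => Set.Icc (-Real.pi) Real.pi),
        Real.cos (phase 3 k m) *
          (∑ z ∈ box 3 L, ∑ z' ∈ box 3 L, G (z' - z) * Real.cos (phase 3 k (z' - z)))
      = (2 * Real.pi) ^ 3 * (G m *
          ((((box 3 L) ×ˢ (box 3 L)).filter (fun p : Site 3 × Site 3 => p.2 - p.1 = m)).card : ℝ)) := by
  have h1 : ∀ k : Fin 3 → ℝ, Real.cos (phase 3 k m) *
        (∑ z ∈ box 3 L, ∑ z' ∈ box 3 L, G (z' - z) * Real.cos (phase 3 k (z' - z)))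
      = ∑ z ∈ box 3 L, ∑ z' ∈ box 3 L,
          G (z' - z) * (Real.cos (phase 3 k m) * Real.cos (phase 3 k (z' - z))) := by
    intro k
    rw [Finset.mul_sum]
    refine Finset.sum_congr rfl fun z _ => ?_
    rw [Finset.mul_sum]
    refine Finset.sum_congr rfl fun z' _ => ?_
    ring
  simp_rw [h1]
  have hi : ∀ z z' : Site 3, Integrable
      (fun k : Fin 3 → ℝ => G (z' - z) * (Real.cos (phase 3 k m) * Real.cos (phase 3 k (z' - z))))
      (volume.restrict (Set.pi Set.univ (fun _ : Fin 3 => Set.Icc (-Real.pi) Real.pi))) := by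
    intro z z'
    refine integrableOn_cube_of_continuous ?_
    have := continuous_phase (d := 3) m
    have := continuous_phase (d := 3) (z' - z)
    fun_prop
  rw [integral_finsetSum _ (fun z _ => integrable_finsetSum _ (fun z' _ => hi z z'))]
  simp_rw [integral_finsetSum _ (fun z' _ => hi _ z'), integral_const_mul, integral_cube_cos_mul_cos]
  have hA : ∑ z ∈ box 3 L, ∑ z' ∈ box 3 L, (if m = z' - z then G (z' - z) else 0)
      = G m * ((((box 3 L) ×ˢ (box 3 L)).filter
          (fun p : Site 3 × Site 3 => p.2 - p.1 = m)).card : ℝ) :=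
    sum_sum_ite_eq_mul_card G (box 3 L) m
  have hB : ∑ z ∈ box 3 L, ∑ z' ∈ box 3 L, (if m = -(z' - z) then G (z' - z) else 0)
      = G m * ((((box 3 L) ×ˢ (box 3 L)).filter
          (fun p : Site 3 × Site 3 => p.2 - p.1 = m)).card : ℝ) := by
    rw [Finset.sum_comm, ← hA]
    refine Finset.sum_congr rfl fun a _ => Finset.sum_congr rfl fun b _ => ?_
    rw [neg_sub]
    by_cases h : m = b - a
    · rw [if_pos h, if_pos h, ← hG (a - b), neg_sub]
    · rw [if_neg h, if_neg h]
  calc ∑ z ∈ box 3 L, ∑ z' ∈ box 3 L, G (z' - z) * ((2 * Real.pi) ^ 3 / 2 *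
          ((if m = z' - z then (1 : ℝ) else 0) + (if m = -(z' - z) then 1 else 0)))
      = (2 * Real.pi) ^ 3 / 2 *
          ((∑ z ∈ box 3 L, ∑ z' ∈ box 3 L, (if m = z' - z then G (z' - z) else 0))
            + ∑ z ∈ box 3 L, ∑ z' ∈ box 3 L, (if m = -(z' - z) then G (z' - z) else 0)) := by
        rw [← Finset.sum_add_distrib, Finset.mul_sum]
        refine Finset.sum_congr rfl fun z _ => ?_
        rw [← Finset.sum_add_distrib, Finset.mul_sum]
        refine Finset.sum_congr rfl fun z' _ => ?_
        split_ifs <;> ring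
    _ = (2 * Real.pi) ^ 3 * (G m * ((((box 3 L) ×ˢ (box 3 L)).filter
          (fun p : Site 3 × Site 3 => p.2 - p.1 = m)).card : ℝ)) := by
        rw [hA, hB]; ring

/-- **Stub A `stub_spectralParseval` (Parseval for quadratic forms against the approximate spectral density;
Ising-free).**  For an even kernel `G` on `ℤ³`, a finite `S`, coefficients `u` and `L`:
`∫_K (Σ_{x,x'∈S} u_x u_{x'} cos k·(x'−x)) · g̃_L(k) dk = (2π)³ Σ_{x,x'∈S} u_x u_{x'} G(x'−x) · #{(z,z') ∈ Λ_L² : z'−z = x'−x}`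
(orthogonality `∫_K cos(k·m)cos(k·n) = (2π)³/2([m=n]+[m=−n])`, `integral_cube_cos_mul_cos`, and the swap `(z,z') ↦ (z',z)`
with evenness for the `m = −n` half). [folklore] -/
theorem stub_spectralParseval :
    ∀ (G : Site 3 → ℝ) (S : Finset (Site 3)) (u : Site 3 → ℝ) (L : ℕ), (∀ w, G (-w) = G w) →
      ∫ k in Set.pi Set.univ (fun _ : Fin 3 => Set.Icc (-Real.pi) Real.pi),
          (∑ x ∈ S, ∑ x' ∈ S, u x * u x' * Real.cos (phase 3 k (x' - x))) *
            (∑ z ∈ box 3 L, ∑ z' ∈ box 3 L, G (z' - z) * Real.cos (phase 3 k (z' - z)))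
        = (2 * Real.pi) ^ 3 * ∑ x ∈ S, ∑ x' ∈ S, u x * u x' * G (x' - x) *
            ((((box 3 L) ×ˢ (box 3 L)).filter (fun p : Site 3 × Site 3 => p.2 - p.1 = x' - x)).card : ℝ) := by
  intro G S u L hG
  rw [integral_quadraticForm_mul S u _ (continuous_approxSpectralDensity G L)]
  rw [Finset.mul_sum]
  refine Finset.sum_congr rfl fun x _ => ?_
  rw [Finset.mul_sum]
  refine Finset.sum_congr rfl fun x' _ => ?_
  rw [integral_cos_mul_approxSpectralDensity G hG L (x' - x)]
  ring

end Summit.CriticalPhenomena.Ising3DConformalLimit.Cruxes.DirectCorrelationStableTail.DiffusiveBranchIsNonsaturation
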